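import Summits.BirchSwinnertonDyer.Rank1Residual.GaloisImage.TatePrimeTorsionInertia
import Summits.BirchSwinnertonDyer.Rank1Residual.GaloisImage.NineTorsionUnipotentWitness
import Literature.NumberTheory.EllipticCurves.WeilPairingProofs
import HarnessLib

/-!
# THE `3`-ADIC TOWER FROM surj(3) AND ONE MULTIPLICATIVE PRIME `ℓ ≠ 3` WITH `9 ∤ v_ℓ(Δ_min)`
# (cell `b2b-bsdres`, team n1011, seat p14 gen 2 — row T-b10 'wild tower at 3', ARM B, target T1
# of `cells/n1011/skel/T-b9x-nine.md`; part 2 of 2, over `GaloisImage/TatePrimeTorsionInertia.lean`)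

HONEST FRAMING (cell `b2b-bsdres`, run/shared/lean/b2b/bsd-rank1-residual/, verbatim in every
file): the goal of the cell is to DELETE the COMBINATION-SHAPED residual classes of the
Birch–Swinnerton-Dyer formula for ALL analytic-rank `≤ 1` elliptic curves over `ℚ` — "full BSD
formula for every rank `≤ 1` curve in class `C`" assembled STRICTLY from published theorems — so
that the rank-`≤ 1` remainder becomes exactly the CONSTRUCTION-SHAPED classes, which are TYPED
(missing-input `Prop`s), NOT attempted. This is not "finishing BSD". Team n1011 (N10 / N11):
research route; no claim beyond the stated classes; labels UNCHANGED; nothing is booked. Theorems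
only (no definition, no named fact).

## What this file proves

* §4 `three_dvd_of_scalar_nine_of_fixing_rootsOfUnity` — a `σ ∈ Γ_ℚ` fixing the `9`-th roots of
  unity acts on `E[9]` as a scalar `1 + 3m` only if `3 ∣ m` (Weil pairing `e₉`, tree
  `exists_weilPairing_holds`: `e₉(σS, σT) = σ e₉(S,T) = e₉(S,T)` forces `6m T = 0` on `E[9]`;
  with `3 ∤ m` Bézout gives `3T = 0`, against `#E[9] = 81 > 9 = #E[3]`).
* §5 **T1 `towerSurj_three_of_surj_of_mult_of_not_nine_dvd`** — for `W/ℚ` elliptic and globally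
  minimal: `ρ̄_{E,3}` onto and a multiplicative prime `ℓ ≠ 3` with `9 ∤ v_ℓ(Δ_min)` ⟹ `ρ̄_{E,3ⁿ}`
  onto for every `n` — NO hypothesis on the reduction at `3` (so it serves the WILD rows of X4 at
  `3`): part 1's global unipotent `σ` (order two on `E[9]`, non-trivial, fixing `μ₉`) is, by §4, of
  "determinant-one type", and `towerSurj_three_of_surj_of_unipotent_nine` (p258295: `σ` or `σ³`
  fixes `E[3]` and is non-scalar on `E[9]`; n1011-p02's torsion-level Serre lifting F1) gives the
  tower.  The sub-case `3 ∤ v_ℓ(Δ_min)` is the tree's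
  `hasSurjectiveModNGaloisRep_pow_of_hasMultiplicativeReductionAtPrime` (census bit ram); the NEW
  content is `v_ℓ(Δ_min) ≡ 3, 6 (mod 9)`.  Census reach (EVIDENCE,
  `HOME/b2b-bsdres-n1011-p14/e9/ram9_reach.json`, 0 disagreements with the census ram bit on the
  20 970 wild surj(3) X4@3 `r_an = 0` cells): 568 of the 1 772 'mod-9 certificate needed' cells
  satisfy the hypothesis (cert-needed ↦ 1 204; with the j-witness twin ↦ 1 141).  Negative side:
  surj(3) ∧ tower fails ⟹ `9 ∣ v_ℓ(Δ_min)` at every multiplicative `ℓ ≠ 3` (contrapositive,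
  `nine_dvd_of_mult_of_surj_of_not_towerSurj_three`) — the signature of Elkies' `9`-deficient
  family (arXiv:math/0612734; his tabulated conductors have no multiplicative prime).

References: [SerreAbelianLadic1968] Ch. IV §3.4 Lemma 3 (IV-23) and A.1.2; [SilvermanAEC2009]
III.8.1 (Weil pairing), III.6.4; [SilvermanATAEC1994] V.4–V.5, Ex. 5.13(b); [Elkies2006]
N. D. Elkies, arXiv:math/0612734.
-/

noncomputable section

open scoped Classical NNReal

open NumberField IsDedekindDomain Field

namespace Summit.BirchSwinnertonDyer.Rank1Residual.GaloisImage

open WeierstrassCurve Literature.NumberTheory.EllipticCurves Literature.NumberTheory.GaloisRepresentations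

section Tower

variable (W : WeierstrassCurve ℚ) [W.IsElliptic] [W.IsGloballyMinimal]

/-! ### §4 Scalars through which a root-of-unity-fixing element can act on `E[9]` -/

omit [W.IsGloballyMinimal] in
/-- **If `σ ∈ Γ_ℚ` fixes the `9`-th roots of unity and acts on `E[9]` as the scalar `1 + 3m`, then
`3 ∣ m`.**  With a Weil pairing `e₉` (tree `exists_weilPairing_holds`): `σ e₉(S,T) = e₉(σS, σT) =
e₉(S,T)^{(1+3m)²}` and `σ e₉(S,T) = e₉(S,T)`, so `e₉(S, ((1+3m)² − 1)T) = 1` for all `S`, whence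
`((1+3m)² − 1) T = 0`, i.e. `6m T = 0`, for every `T ∈ E[9]`; if `3 ∤ m` this gives `3T = 0` on
`E[9]`, against `#E[9] = 81 > 9 = #E[3]`. [cite: SilvermanAEC2009, Prop. III.8.1 and Cor. III.6.4(b)] -/
theorem three_dvd_of_scalar_nine_of_fixing_rootsOfUnity (σ : absoluteGaloisGroup ℚ)
    (hζ : ∀ ζ : AlgebraicClosure ℚ, ζ ^ 9 = 1 → σ • ζ = ζ) (m : ℕ)
    (hm : ∀ Q ∈ geomTorsion W 9, σ • Q = (1 + 3 * m) • Q) : 3 ∣ m := by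
  by_contra h3m
  -- a Weil pairing on `E[9]`
  obtain ⟨e, he9, heL, heR, -, hend, hegal⟩ :=
    exists_weilPairing_holds W 9 (by norm_num) (by norm_num)
  -- every `T ∈ E[9]` has `3 T = 0`
  have h3 : ∀ T : geomTorsion W 9, (3 : ℕ) • T = 0 := by
    intro T
    -- `6m T = 0` from the pairing, and Bezout with `3 ∤ m`
    have h6 : (6 * m) • T = 0 := by
      apply hend
      intro S
      -- `e S ((6m) T) = e S T ^ (6m)` and `e(σS, σT) = e S T ^ ((1+3m)²) = σ (e S T) = e S T`
      have hpowR : ∀ (j : ℕ) (S' T' : geomTorsion W 9), e S' (j • T') = e S' T' ^ j := by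
        intro j S' T'
        induction j with
        | zero =>
          rw [zero_smul, pow_zero]
          have h := heR S' 0 0
          rw [add_zero] at h
          have hne0 : e S' 0 ≠ 0 := fun h0 ↦ by
            have := he9 S' 0; rw [h0, zero_pow (by norm_num)] at this; exact zero_ne_one this
          exact (mul_right_eq_self₀.mp h.symm).resolve_right hne0
        | succ j ih => rw [add_smul, one_smul, heR, ih, pow_succ]
      have hpowL : ∀ (j : ℕ) (S' T' : geomTorsion W 9), e (j • S') T' = e S' T' ^ j := by
        intro j S' T'
        induction j with
        | zero =>
          rw [zero_smul, pow_zero]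
          have h := heL 0 0 T'
          rw [add_zero] at h
          have hne0 : e 0 T' ≠ 0 := fun h0 ↦ by
            have := he9 0 T'; rw [h0, zero_pow (by norm_num)] at this; exact zero_ne_one this
          exact (mul_right_eq_self₀.mp h.symm).resolve_right hne0
        | succ j ih => rw [add_smul, one_smul, heL, ih, pow_succ]
      have hσS : σ • S = (1 + 3 * m) • S := by
        apply Subtype.ext
        rw [Literature.NumberTheory.EllipticCurves.AddSubgroup.torsionBy.coe_smul, AddSubmonoidClass.coe_nsmul]
        exact hm S S.2
      have hσT : σ • T = (1 + 3 * m) • T := by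
        apply Subtype.ext
        rw [Literature.NumberTheory.EllipticCurves.AddSubgroup.torsionBy.coe_smul, AddSubmonoidClass.coe_nsmul]
        exact hm T T.2
      have hfix : σ • e S T = e S T := hζ _ (he9 S T)
      have key : e S T ^ ((1 + 3 * m) * (1 + 3 * m)) = e S T :=
        calc e S T ^ ((1 + 3 * m) * (1 + 3 * m))
            = e ((1 + 3 * m) • S) ((1 + 3 * m) • T) := by rw [hpowL, hpowR, ← pow_mul]
          _ = e (σ • S) (σ • T) := by rw [hσS, hσT]
          _ = σ • e S T := (hegal σ S T).symm
          _ = e S T := hfix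
      -- so `e S T ^ (6m) = 1` (`(1+3m)² = 1 + 6m + 9m²`, `e S T ^ 9 = 1`)
      have h9 : e S T ^ 9 = 1 := he9 S T
      have hne : e S T ≠ 0 := fun h0 ↦ by rw [h0, zero_pow (by norm_num)] at h9; exact zero_ne_one h9
      have hexp : (1 + 3 * m) * (1 + 3 * m) = 1 + 6 * m + 9 * m ^ 2 := by ring
      have h9m : e S T ^ (9 * m ^ 2) = 1 := by rw [pow_mul, h9, one_pow]
      rw [hexp, pow_add, h9m, mul_one, pow_add, pow_one] at key
      rw [hpowR]
      exact (mul_right_eq_self₀.mp key).resolve_right hne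
    -- Bezout: `3 T = 0` from `6m T = 0` and `9 T = 0`
    have h9T : (9 : ℕ) • T = 0 := by
      apply Subtype.ext
      rw [AddSubmonoidClass.coe_nsmul, ZeroMemClass.coe_zero, ← natCast_zsmul]
      exact (Submodule.mem_torsionBy_iff _ _).mp T.2
    have hcop : Nat.Coprime m 3 := ((Nat.Prime.coprime_iff_not_dvd Nat.prime_three).mpr h3m).symm
    obtain ⟨b, -, hb⟩ := Nat.exists_mul_mod_eq_one_of_coprime hcop (by norm_num)
    have hdm : 3 * (m * b / 3) + 1 = m * b := by
      have := Nat.div_add_mod (m * b) 3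
      rw [hb] at this
      exact this
    -- `3 T = 3 (m b) T - 9 (m b / 3) T = b/2 … `: compute `(3 * (m * b)) • T` two ways
    have hA : (3 * (m * b)) • T = (3 : ℕ) • T := by
      rw [← hdm, mul_add, mul_one, add_smul, show 3 * (3 * (m * b / 3)) = (m * b / 3) * 9 by ring,
        mul_smul, h9T, smul_zero, zero_add]
    have hB : (3 * (m * b)) • T = 0 := by
      obtain ⟨b', hb'⟩ : ∃ b', b = 2 * b' ∨ b = 2 * b' + 1 := ⟨b / 2, by omega⟩
      -- use `6m T = 0`: `3 m b = (6m) (b/2)` if `b` even; else `3 m b = 6m b' + 3m` … instead: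
      -- `2 • (3 m b) • T = b • (6m) • T = 0` and `9 • … = 0`, so `(3 m b) • T` is killed by 2 and 9
      have h2 : 2 • ((3 * (m * b)) • T) = 0 := by
        rw [← mul_smul, show 2 * (3 * (m * b)) = b * (6 * m) by ring, mul_smul, h6, smul_zero]
      have h9' : (9 : ℕ) • ((3 * (m * b)) • T) = 0 := by
        rw [← mul_smul, mul_comm, mul_smul, h9T, smul_zero]
      -- `1 = 5·2 − 9`
      calc (3 * (m * b)) • T = (10 - 9 : ℕ) • ((3 * (m * b)) • T) := by rw [show (10 - 9 : ℕ) = 1 from rfl, one_smul]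
        _ = 0 := by
          have : (10 : ℕ) • ((3 * (m * b)) • T) = 0 := by
            rw [show (10 : ℕ) = 5 * 2 from rfl, mul_smul, h2, smul_zero]
          have h10 : (10 : ℕ) • ((3 * (m * b)) • T) = (9 : ℕ) • ((3 * (m * b)) • T) +
              (1 : ℕ) • ((3 * (m * b)) • T) := by rw [← add_smul]
          rw [this, h9', zero_add, one_smul] at h10
          rw [show (10 - 9 : ℕ) = 1 from rfl, one_smul]
          exact h10.symm
    rw [← hA]; exact hB
  -- hence `E[9] ⊆ E[3]`, contradicting the cardinalities `81` and `9`
  have hcard9 : Nat.card (geomTorsion W 9) = 9 ^ 2 := by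
    have := card_torsionPoints_eq_sq_holds W (AlgebraicClosure ℚ) (n := 9) (by norm_num)
    exact this
  have hcard3 : Nat.card (geomTorsion W 3) = 3 ^ 2 := by
    have := card_torsionPoints_eq_sq_holds W (AlgebraicClosure ℚ) (n := 3) (by norm_num)
    exact this
  have hle : Nat.card (geomTorsion W 9) ≤ Nat.card (geomTorsion W 3) := by
    haveI : Finite (geomTorsion W 3) := Nat.finite_of_card_ne_zero (by rw [hcard3]; norm_num)
    refine Nat.card_le_card_of_injective (fun T ↦ ⟨(T : W.geomPoints), ?_⟩) ?_
    · refine (Submodule.mem_torsionBy_iff _ _).mpr ?_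
      change (3 : ℤ) • (T : W.geomPoints) = 0
      have h' : (3 : ℕ) • (T : W.geomPoints) = 0 := by
        have := congrArg (fun X : geomTorsion W 9 ↦ (X : W.geomPoints)) (h3 T)
        simpa only [AddSubmonoidClass.coe_nsmul, ZeroMemClass.coe_zero] using this
      rw [← natCast_zsmul] at h'
      exact_mod_cast h'
    · intro T T' h
      simp only [Subtype.mk.injEq] at h
      exact Subtype.ext h
  rw [hcard9, hcard3] at hle
  omega

/-! ### §5 T1: the `3`-adic tower from surj(3) and a Tate prime with `9 ∤ v_ℓ(Δ_min)` -/

/-- **T1. THE `3`-ADIC TOWER FROM surj(3) AND ONE MULTIPLICATIVE PRIME `ℓ ≠ 3` WITH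
`9 ∤ v_ℓ(Δ_min)`.**  For `W/ℚ` elliptic and globally minimal: if `ρ̄_{E,3}` is onto and `E` has
multiplicative reduction at a prime `ℓ ≠ 3` with `9 ∤ v_ℓ(Δ_min)`, then `ρ̄_{E,3ⁿ}` is onto for
every `n`.  Inertia at `ℓ` gives `σ ∈ Γ_ℚ` unipotent of order two and non-trivial on `E[9]` fixing
`μ₉` (§3), hence acting through no scalar `1 + 3m` with `3 ∤ m` (§4); the unipotent-witness lemma
`towerSurj_three_of_surj_of_unipotent_nine` (Serre IV-23 via n1011-p02's torsion-level lifting)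
concludes.  The sub-case `3 ∤ v_ℓ(Δ_min)` is the tree's
`hasSurjectiveModNGaloisRep_pow_of_hasMultiplicativeReductionAtPrime`; NEW: `v_ℓ(Δ_min) ≡ 3, 6
(mod 9)`.  No hypothesis on the reduction of `E` at `3`.
[cite: SerreAbelianLadic1968, Ch. IV §3.4 Lemma 3 (IV-23) and A.1.2]
[cite: SilvermanATAEC1994, V.4–V.5 and Exercise 5.13(b) (PDF p. 416)] [cite: Elkies2006, §1] -/
theorem towerSurj_three_of_surj_of_mult_of_not_nine_dvd (hsurj : W.HasSurjectiveModNGaloisRep 3)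
    {ℓ : ℕ} [Fact ℓ.Prime] (hℓ : ℓ ≠ 3) (hmult : W.HasMultiplicativeReductionAtPrime ℓ)
    (h9 : ¬ 9 ∣ padicValNat ℓ W.minimalDiscriminantInt.natAbs) (n : ℕ) :
    W.HasSurjectiveModNGaloisRep (3 ^ n : ℕ) := by
  obtain ⟨σ, hU, ⟨Q, hQ, hσQ⟩, hζ⟩ := exists_unipotent_pow_of_mult_of_not_pow_dvd W Nat.prime_three hℓ
    hmult (k := 2) (by norm_num) (by norm_num; exact h9)
  have h9eq : (((3 ^ 2 : ℕ) : ℤ)) = 9 := by norm_num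
  rw [h9eq] at hU hQ
  refine towerSurj_three_of_surj_of_unipotent_nine W hsurj σ hU ⟨Q, hQ, hσQ⟩ (fun m hm ↦ ?_) n
  exact three_dvd_of_scalar_nine_of_fixing_rootsOfUnity W σ (fun ζ h ↦ hζ ζ (by norm_num; exact h)) m hm

/-- **The negative side (typed obstruction): surj(3) and a FAILING `3`-adic tower force
`9 ∣ v_ℓ(Δ_min)` at every multiplicative prime `ℓ ≠ 3`** (contrapositive of T1) — the signature of
Elkies' `9`-deficient images (arXiv:math/0612734: `ρ̄_{E,9}(Γ_ℚ) ∩ (1 + 3M₂(ℤ/9))` = scalars, so a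
Tate prime would need its unipotent `(1 v; 0 1)` to be scalar mod `9`). [cite: Elkies2006, §1]
[cite: SerreAbelianLadic1968, Ch. IV, A.1.2] -/
theorem nine_dvd_of_mult_of_surj_of_not_towerSurj_three (hsurj : W.HasSurjectiveModNGaloisRep 3)
    (hnot : ¬ ∀ n : ℕ, W.HasSurjectiveModNGaloisRep (3 ^ n : ℕ))
    {ℓ : ℕ} [Fact ℓ.Prime] (hℓ : ℓ ≠ 3) (hmult : W.HasMultiplicativeReductionAtPrime ℓ) :
    9 ∣ padicValNat ℓ W.minimalDiscriminantInt.natAbs := by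
  by_contra h9
  exact hnot (towerSurj_three_of_surj_of_mult_of_not_nine_dvd W hsurj hℓ hmult h9)

end Tower

end Summit.BirchSwinnertonDyer.Rank1Residual.GaloisImage

end
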